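import Summits.HubbardSuperconductivity.HubbardSuperconductivity.Theses.AposterioriCapRg
import Summits.HubbardSuperconductivity.HubbardSuperconductivity.Theorems.SeededBrokenRegimeBoseFermiPinned.Negative.LoadBearing
import Summits.HubbardSuperconductivity.HubbardSuperconductivity.Theorems.AposterioriCapRgSeededBrokenRegimeBoseFermiPinnedSeedSliceBound
import Summits.HubbardSuperconductivity.HubbardSuperconductivity.Theorems.AposterioriCapRgSeededBrokenRegimeBoseFermiPinnedSeedConvolution
import Summits.HubbardSuperconductivity.HubbardSuperconductivity.Theorems.AposterioriCapRgSeededBrokenRegimeBoseFermiPinnedSeedSliceCovarianceBound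
import Summits.HubbardSuperconductivity.HubbardSuperconductivity.Theorems.AposterioriCapRgSeededBrokenRegimeBoseFermiPinnedSeedRotationIdentity
import Summits.HubbardSuperconductivity.HubbardSuperconductivity.Theorems.AposterioriCapRgSeededBrokenRegimeBoseFermiPinnedLoosenedDatum
import Summits.HubbardSuperconductivity.HubbardSuperconductivity.Theorems.AposterioriCapRgSeededBrokenRegimeBoseFermiPinnedSeedSliceCovarianceSupport

/-!
# Line `seed-strength-flow` — skeleton v4 for crux `SeededBrokenRegimeBoseFermiPinned` (stmt-HubbardSuperconductivity-14047)

Second lead `prover-line-stmt-HubbardSuperconductivity-14047-1`, 2026-08-16 (continues the first lead's v3: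
S1 S2 S3 S6 S7 S8 LANDED and imported; S4 ANCHOR / S5 STEP registered verbatim in v3 model form with the scale
cap and PARKED pending the planner's restatement of the crux — cdisprove c2/c3: the `∀ etaStar` remainder
floor of D1″ is crux-level; new in v4: the restatement-invariant ingredient stubs S9–S11 that ANCHOR and STEP
both need first).

## The line

Above a fermionic infrared scale `Λ₀` the Koma–Tasaki pair seed `h` is a regular GAUSSIAN parameter of the
countertermed effective action `𝒢_h := hubbardEffectiveActionCT L M β U μ h K Λ₀`: the seed sits in the
covariance only.  (S2) `𝒢_h = effAction (C^{>Λ₀}_h − C^{>Λ₀}_{h₀}) 𝒢_{h₀}` exactly; (S1, S3, S8) the seed-slice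
covariance is supported above `Λ₀/2` and of sup-size `≤ 32√2·βL²|h − h₀|/Λ₀²`.  The crux is cut as ANCHOR ∧ STEP:
(S4) the crux's conclusion-shape at the single massive anchor seed `h₀ := D.scale/4` with slack; (S5) lowering
the seed to every `h ∈ (0, h₀)` keeps the realised tuples in the factor-two box of `D`; (S7) the loosened datum
encloses that box.  The FIRST LEMMA both S4 and S5 need is the global `U(1)` × seed covariance of `𝒢_h` at the
Grassmann level (S9: the charge scaling `ψ⁺ ↦ zψ⁺`, `ψ⁻ ↦ z⁻¹ψ⁻` maps `𝒢_h` to the effective action of the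
charge-scaled covariance — the complex-seed family; S10a seed parity `𝒢_{−h} = S_i 𝒢_h`; S10b charge neutrality
of the kernels of `𝒢_0`), and the seed-flow equation along S2's convolution is the coefficientwise Gaussian-parameter
flow equation S11 (Salmhofer's (4.89) with `t ↦ C_t` any differentiable covariance path).

## Composition

`SeededBrokenRegimeBoseFermiPinned_of`: pure logic over the report API — `Θ :=` componentwise `min` of the
tolerances of S4 and S5 (`Negative.certificateT_mono_tol`); `D` from ANCHOR, realised-eventually-in-`M` tuples
are reported (`mem_hubbardScaleReportCTAt_of_eventually`), so `D` is certified at `h₀ = D.scale/4`; STEP puts the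
tuples at `h < h₀` in the factor-two box; S7's loosened `D'` (same scale / patches / nodal set, hence the same
report) encloses both; `h₀ := D.scale/4 > 0`.  The density clause and `δ` are not used (`CruxNoDens` shape).
-/

set_option linter.dupNamespace false

namespace Summit.HubbardSuperconductivity.HubbardSuperconductivity.Lines.SeededBrokenRegimeBoseFermiPinned.SeedStrengthFlow

open Summit.HubbardSuperconductivity.HubbardSuperconductivity.Theses.AposterioriCapRg
open Summit.HubbardSuperconductivity.HubbardSuperconductivity.Theorems.SeededBrokenRegimeBoseFermiPinned
open Summit.HubbardSuperconductivity.HubbardSuperconductivity.Theorems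
open Literature.MathematicalPhysics.QuantumLattice Literature.Probability.LatticeModels GrassmannAlgebra Filter
open scoped Matrix ComplexConjugate

/-! ### S1 — the seed is a regular Gaussian parameter above scale (LANDED p80662) -/

/-- **S1 (`SeedSliceBound`)**: above a fermionic scale `Λ` every entry of the seeded Nambu propagator in the
frame `K` is differentiable in the seed strength with `‖∂_h G_ab‖ ≤ |φ_d|/Λ²`. -/
theorem stub_seedSliceBound :
    ∀ (L M : ℕ) [NeZero L] (β μ Λ h : ℝ) (K : TrigPolyC4v) (k : FreqMomentum L M) (i j : Fin 2),
      0 < Λ → Λ ^ 2 ≤ matsubaraFreq β M k.1 ^ 2 + nambuXiCT L μ K k.2 ^ 2 →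
        DifferentiableAt ℝ (fun h' : ℝ => nambuPropagatorCT L M β μ h' K k i j) h ∧
        ‖deriv (fun h' : ℝ => nambuPropagatorCT L M β μ h' K k i j) h‖ ≤ |dWaveSymbol L k.2| / Λ ^ 2 :=
  AposterioriCapRgSeededBrokenRegimeBoseFermiPinned.stub_seedSliceBound

/-! ### S2 — Gaussian additivity in the seed (LANDED p80724) -/

/-- **S2 (`SeedConvolution`)**: `𝒢_h = effAction (C^{>Λ₀}_h − C^{>Λ₀}_{h₀}) 𝒢_{h₀}` when `Z_{h₀} ≠ 0`. -/
theorem stub_seedConvolution :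
    ∀ (L M : ℕ) [NeZero L] (β U μ h h₀ : ℝ) (K : TrigPolyC4v) (Λ₀ : ℝ),
      hubbardEffPartitionFnCT L M β U μ h₀ K Λ₀ ≠ 0 →
        hubbardEffectiveActionCT L M β U μ h K Λ₀ =
          effAction ℂ (hubbardCovAboveCT L M β μ h K Λ₀ - hubbardCovAboveCT L M β μ h₀ K Λ₀)
            (hubbardEffectiveActionCT L M β U μ h₀ K Λ₀) :=
  AposterioriCapRgSeededBrokenRegimeBoseFermiPinned.stub_seedConvolution

/-! ### S3 — the seed-slice covariance is small (LANDED p80516) -/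

/-- **S3 (`SeedSliceCovarianceBound`)**: given S1, the seed-slice covariance above `Λ₀` is entrywise
`≤ 32√2 · βL² · |h − h₀| / Λ₀²`. -/
theorem stub_seedSliceCovarianceBound :
    (∀ (L M : ℕ) [NeZero L] (β μ Λ h : ℝ) (K : TrigPolyC4v) (k : FreqMomentum L M) (i j : Fin 2),
      0 < Λ → Λ ^ 2 ≤ matsubaraFreq β M k.1 ^ 2 + nambuXiCT L μ K k.2 ^ 2 →
        DifferentiableAt ℝ (fun h' : ℝ => nambuPropagatorCT L M β μ h' K k i j) h ∧
        ‖deriv (fun h' : ℝ => nambuPropagatorCT L M β μ h' K k i j) h‖ ≤ |dWaveSymbol L k.2| / Λ ^ 2) →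
    ∀ (L M : ℕ) [NeZero L] (β μ h h₀ : ℝ) (K : TrigPolyC4v) (Λ₀ : ℝ) (X Y : HubbardFieldIdx L M),
      0 < β → 0 < Λ₀ →
        ‖hubbardCovAboveCT L M β μ h K Λ₀ X Y - hubbardCovAboveCT L M β μ h₀ K Λ₀ X Y‖ ≤
          32 * Real.sqrt 2 * β * (L : ℝ) ^ 2 * |h - h₀| / Λ₀ ^ 2 :=
  AposterioriCapRgSeededBrokenRegimeBoseFermiPinned.stub_seedSliceCovarianceBound

/-! ### S8 — the seed-slice covariance lives above `Λ₀/2` (LANDED p84771) -/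

/-- **S8 (`SeedSliceCovarianceSupport`)**: on labels with `ω² + e_K² ≤ Λ₀²/4` the covariance above `Λ₀` does not
depend on the seed. -/
theorem stub_seedSliceCovarianceSupport :
    ∀ (L M : ℕ) [NeZero L] (β μ h h₀ : ℝ) (K : TrigPolyC4v) (Λ₀ : ℝ) (X Y : HubbardFieldIdx L M),
      matsubaraFreq β M (momentumOf L M X).1 ^ 2 + nambuXiCT L μ K (momentumOf L M X).2 ^ 2 ≤ Λ₀ ^ 2 / 4 →
        hubbardCovAboveCT L M β μ h K Λ₀ X Y = hubbardCovAboveCT L M β μ h₀ K Λ₀ X Y :=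
  AposterioriCapRgSeededBrokenRegimeBoseFermiPinned.stub_seedSliceCovarianceSupport

/-! ### S6 — the rotation identity at the Hamiltonian level (LANDED p81838) -/

/-- **S6 (`SeedRotationIdentity`)**: the ground energy of the torus seeded by a complex `d`-wave pair source
depends on the modulus of the source only. -/
theorem stub_seedRotationIdentity :
    ∀ (L : ℕ) [NeZero L] (U μ a b : ℝ),
      Matrix.groundEnergy (hubbardTorusWith 2 L 1 U μ
          - (a : ℂ) • (pairField dWaveFormFactor L + (pairField dWaveFormFactor L)ᴴ)
          - (b : ℂ) • (Complex.I • ((pairField dWaveFormFactor L)ᴴ - pairField dWaveFormFactor L)))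
        = Matrix.groundEnergy (dWaveSourceTorus L U μ (Real.sqrt (a ^ 2 + b ^ 2))) :=
  AposterioriCapRgSeededBrokenRegimeBoseFermiPinned.stub_seedRotationIdentity

/-! ### S7 — loosening the slack datum (LANDED p83751) -/

/-- **S7 (`LoosenedDatum`)**: a datum meeting the anchor thresholds with slack is loosened (same scale, patches,
nodal set) to one meeting `MeetsThresholds kStar etaStar`, enclosing `D`'s tuples and the factor-two box. -/
theorem stub_loosenedDatum :
    ∀ (D : HubbardScaleData) (kStar etaStar : ℚ), 0 < kStar → 0 < etaStar →
      D.MeetsThresholdsWith 20 (2 * kStar) (etaStar / 2) → 0 < D.meanFieldDensity.fst →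
        ∃ (gap' : Fin D.numPatches → NonemptyInterval ℚ) (ρ' κ' vF' vΔ' η' m₀' : NonemptyInterval ℚ),
          (HubbardScaleData.mk D.scale D.scale_pos D.numPatches D.nodal gap' ρ' κ' vF' vΔ' η' m₀').MeetsThresholds
              kStar etaStar ∧
          0 < m₀'.fst ∧
          (∀ p : HubbardScaleData.Parameters D.numPatches, D.Encloses p →
            (HubbardScaleData.mk D.scale D.scale_pos D.numPatches D.nodal gap' ρ' κ' vF' vΔ' η' m₀').Encloses p) ∧
          (∀ p : HubbardScaleData.Parameters D.numPatches, 0 ≤ p.remainderNorm →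
            ((∀ i, ((D.gap i).fst : ℝ) - 10 * (D.scale : ℝ) ≤ p.gap i ∧ p.gap i ≤ ((D.gap i).snd : ℝ) + 10 * (D.scale : ℝ)) ∧
                  2 / 3 * (D.stiffness.fst : ℝ) ≤ p.stiffness ∧ p.stiffness ≤ 2 * (D.stiffness.snd : ℝ) ∧
                  (D.compressibility.fst : ℝ) / 2 ≤ p.compressibility ∧
                  p.compressibility ≤ 2 * (D.compressibility.snd : ℝ) ∧
                  (D.fermiVelocity.fst : ℝ) / 2 ≤ p.fermiVelocity ∧ p.fermiVelocity ≤ 4 / 3 * (D.fermiVelocity.snd : ℝ) ∧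
                  (D.gapVelocity.fst : ℝ) / 2 ≤ p.gapVelocity ∧ p.gapVelocity ≤ 4 / 3 * (D.gapVelocity.snd : ℝ) ∧
                  p.remainderNorm ≤ 2 * (D.remainderNorm.snd : ℝ) ∧
                  (D.meanFieldDensity.fst : ℝ) / 2 ≤ p.meanFieldDensity ∧
                  p.meanFieldDensity ≤ 2 * (D.meanFieldDensity.snd : ℝ)) →
              (HubbardScaleData.mk D.scale D.scale_pos D.numPatches D.nodal gap' ρ' κ' vF' vΔ' η' m₀').Encloses p) :=
  AposterioriCapRgSeededBrokenRegimeBoseFermiPinned.stub_loosenedDatum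

/-! ### S9 — global `U(1)` × seed covariance of the countertermed effective action (Grassmann level) -/

/-- **S9 (`ChargeSeedCovariance`)**: the charge scaling `ψ⁺ ↦ z ψ⁺`, `ψ⁻ ↦ z⁻¹ ψ⁻` (`z ≠ 0`; `z = e^{iα}` is the
global `U(1)` rotation) maps the effective action at seed `h` in the frame `K` at scale `Λ` to the effective action,
for the SAME (charge-conserving) interaction `V_K`, of the charge-scaled covariance
`(X, Y) ↦ w(X) w(Y) C^{K,>Λ}_h(X, Y)`, `w(ψ⁺) = z⁻¹`, `w(ψ⁻) = z` — i.e. of the covariance whose anomalous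
`ψ⁺ψ⁺` / `ψ⁻ψ⁻` blocks carry the complex seeds `h z⁻²` / `h z²` (the rotation identity "verbatim for every cutoff
Grassmann integral": interaction, frame and Salmhofer's cutoff are functions of the invariants only). -/
theorem stub_chargeSeedCovariance :
    ∀ (L M : ℕ) [NeZero L] (β U μ h : ℝ) (K : TrigPolyC4v) (Λ : ℝ) (z : ℂ), z ≠ 0 →
      ExteriorAlgebra.map (LinearMap.mulLeft ℂ (fun X : HubbardFieldIdx L M => if X.2 = 0 then z else z⁻¹))
          (hubbardEffectiveActionCT L M β U μ h K Λ) =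
        effAction ℂ
          (Matrix.of fun X Y : HubbardFieldIdx L M =>
            (if X.2 = 0 then z⁻¹ else z) * (if Y.2 = 0 then z⁻¹ else z) * hubbardCovAboveCT L M β μ h K Λ X Y)
          (hubbardInteractionCT L M β U K) := by
  sorry

/-! ### S10a — seed parity -/

/-- **S10a (`SeedParity`)**: reversing the seed is the charge scaling by `i`: `𝒢_{−h} = S_i 𝒢_h`
(`ψ⁺ ↦ iψ⁺`, `ψ⁻ ↦ −iψ⁻`; the anomalous covariance blocks are odd in `h`, the normal ones even). -/
theorem stub_seedParity :
    ∀ (L M : ℕ) [NeZero L] (β U μ h : ℝ) (K : TrigPolyC4v) (Λ : ℝ),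
      hubbardEffectiveActionCT L M β U μ (-h) K Λ =
        ExteriorAlgebra.map
          (LinearMap.mulLeft ℂ (fun X : HubbardFieldIdx L M => if X.2 = 0 then Complex.I else -Complex.I))
          (hubbardEffectiveActionCT L M β U μ h K Λ) := by
  sorry

/-! ### S10b — charge neutrality of the kernels at zero seed -/

/-- **S10b (`ChargeNeutrality`)**: without seed the effective action is `U(1)`-invariant, so every kernel with
unequal numbers of `ψ⁺` and `ψ⁻` legs vanishes (no anomalous vertex is generated at `h = 0`, in any frame, at any
scale, for every finite `L, M, β`). -/
theorem stub_chargeNeutrality :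
    ∀ (L M : ℕ) [NeZero L] (β U μ : ℝ) (K : TrigPolyC4v) (Λ : ℝ) (m : ℕ) (X : Fin m → HubbardFieldIdx L M),
      (Finset.univ.filter fun i => (X i).2 = 0).card ≠ (Finset.univ.filter fun i => (X i).2 = 1).card →
        kernel ℂ (hubbardEffectiveActionCT L M β U μ 0 K Λ) m X = 0 := by
  sorry

/-! ### S11 — the coefficientwise Gaussian-parameter flow equation (Salmhofer (4.89) for any covariance path) -/

/-- **S11 (`GaussConvFlow`)**: along a covariance path `t ↦ C_t` differentiable entrywise, every kernel of the
Gaussian convolution `μ_{C_t} ⋆ F = e^{Δ_{C_t}} F` is differentiable in `t` with derivative the corresponding kernel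
of `Δ_{Ċ_t} (μ_{C_t} ⋆ F)` (the Laplacians commute; the seed-flow equation of the line is the case
`C_t = C^{K,>Λ₀}_{h = t}`, whose entrywise derivative S1 bounds). -/
theorem stub_gaussConvFlow :
    ∀ {Γ : Type} [Fintype Γ] [DecidableEq Γ] (C : ℝ → Matrix Γ Γ ℂ) (C' : Matrix Γ Γ ℂ) (t : ℝ),
      (∀ X Y, HasDerivAt (fun s => C s X Y) (C' X Y) t) →
      ∀ (F : GrassmannAlgebra ℂ Γ) (m : ℕ) (X : Fin m → Γ),
        HasDerivAt (fun s => kernel ℂ (gaussConv ℂ (C s) F) m X)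
          (kernel ℂ (grassmannLaplacian ℂ C' (gaussConv ℂ (C t) F)) m X) t := by
  sorry

/-! ### S4 — ANCHOR (v3 model form with the scale cap; PARKED pending the crux restatement) -/

/-- **S4 (`AnchorFlow`, ANCHOR)**: for all thresholds there is a tolerance such that at every certified point of the
box there is a scale datum at a scale `≤ Λ·e⁻⁸/30` meeting the thresholds with SLACK (gap ratio `20`, `(2·kStar,
etaStar/2)`, `0 < N_p`, `0 < m₀.fst`) whose enclosed tuples are realised, in one admissible frame and for all
large `M`, at the single anchor seed `h₀ = D.scale/4`, for all `L ≥ L₁` and `β ≥ β₀(L)`.  Crux-strength;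
cdisprove §12: false in principle below an anchor floor `≈ 3·10⁻⁵` under `∀ etaStar` — parked. -/
theorem stub_anchorFlow :
    ∀ kStar etaStar : ℚ, 0 < kStar → 0 < etaStar → ∃ Θ : SymmetricTolerance,
      ∀ U ∈ Set.Icc (2:ℝ) 3, ∀ (μ : ℝ) (K : TrigPolyC4v) (Λ : ℝ) (L₀ : ℕ),
        symmetricRegimeCertificateT U μ capRgCornerDataT Θ K Λ L₀ →
          ∃ D : HubbardScaleData, (D.scale : ℝ) ≤ Λ * Real.exp (-8) / 30 ∧
            D.MeetsThresholdsWith 20 (2 * kStar) (etaStar / 2) ∧ 0 < D.numPatches ∧ 0 < D.meanFieldDensity.fst ∧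
            ∃ L₁ : ℕ, ∀ L : ℕ, L₁ ≤ L → ∀ [NeZero L], ∃ β₀ : ℝ, ∀ β : ℝ, β₀ ≤ β →
              ∃ K' : TrigPolyC4v, IsAdmissibleFrame K' ∧ ∃ p : HubbardScaleData.Parameters D.numPatches,
                D.Encloses p ∧ ∀ᶠ M in Filter.atTop,
                  IsRealisedAtCT L M β U μ ((D.scale : ℝ) / 4) K' (D.scale : ℝ) D.numPatches D.nodal p := by
  sorry

/-! ### S5 — STEP (v3 model form with the scale cap; PARKED: `stub-misstated` by cdisprove c2 at crux level) -/

/-- **S5 (`SeedLowering`, STEP)**: at every certified point, every datum at a capped scale certified WITH SLACK at its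
anchor seed `D.scale/4` keeps, at every seed `h ∈ (0, D.scale/4)`, realised tuples inside the factor-two box of `D`
(one admissible frame, all large `M`, `L ≥ L₁(h)`, `β ≥ β₀(L)`).  Crux-strength; inherits the crux-level `∀ etaStar`
floor of D1″ (cdisprove §10) — parked pending restatement. -/
theorem stub_seedLowering :
    ∀ kStar etaStar : ℚ, 0 < kStar → 0 < etaStar → ∃ Θ : SymmetricTolerance,
      ∀ U ∈ Set.Icc (2:ℝ) 3, ∀ (μ : ℝ) (K : TrigPolyC4v) (Λ : ℝ) (L₀ : ℕ),
        symmetricRegimeCertificateT U μ capRgCornerDataT Θ K Λ L₀ →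
          ∀ D : HubbardScaleData, (D.scale : ℝ) ≤ Λ * Real.exp (-8) / 30 →
            D.MeetsThresholdsWith 20 (2 * kStar) (etaStar / 2) → 0 < D.numPatches → 0 < D.meanFieldDensity.fst →
            (∃ L₀' : ℕ, D.IsCertifiedEnclosure (hubbardScaleReportCT U μ D ((D.scale : ℝ) / 4)) L₀') →
              ∀ h ∈ Set.Ioo (0:ℝ) ((D.scale : ℝ) / 4), ∃ L₁ : ℕ, ∀ L : ℕ, L₁ ≤ L → ∀ [NeZero L],
                ∃ β₀ : ℝ, ∀ β : ℝ, β₀ ≤ β → ∃ K' : TrigPolyC4v, IsAdmissibleFrame K' ∧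
                  ∃ p : HubbardScaleData.Parameters D.numPatches,
                    ((∀ i, ((D.gap i).fst : ℝ) - 10 * (D.scale : ℝ) ≤ p.gap i ∧
                          p.gap i ≤ ((D.gap i).snd : ℝ) + 10 * (D.scale : ℝ)) ∧
                        2 / 3 * (D.stiffness.fst : ℝ) ≤ p.stiffness ∧ p.stiffness ≤ 2 * (D.stiffness.snd : ℝ) ∧
                        (D.compressibility.fst : ℝ) / 2 ≤ p.compressibility ∧
                        p.compressibility ≤ 2 * (D.compressibility.snd : ℝ) ∧
                        (D.fermiVelocity.fst : ℝ) / 2 ≤ p.fermiVelocity ∧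
                        p.fermiVelocity ≤ 4 / 3 * (D.fermiVelocity.snd : ℝ) ∧
                        (D.gapVelocity.fst : ℝ) / 2 ≤ p.gapVelocity ∧ p.gapVelocity ≤ 4 / 3 * (D.gapVelocity.snd : ℝ) ∧
                        p.remainderNorm ≤ 2 * (D.remainderNorm.snd : ℝ) ∧
                        (D.meanFieldDensity.fst : ℝ) / 2 ≤ p.meanFieldDensity ∧
                        p.meanFieldDensity ≤ 2 * (D.meanFieldDensity.snd : ℝ)) ∧
                    ∀ᶠ M in Filter.atTop, IsRealisedAtCT L M β U μ h K' (D.scale : ℝ) D.numPatches D.nodal p := by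
  sorry

/-! ### Composition (pure logic over the report API) -/

/-- The componentwise minimum of two tolerances. -/
def minTol (Θ₁ Θ₂ : SymmetricTolerance) : SymmetricTolerance where
  mismatch := min Θ₁.mismatch Θ₂.mismatch
  mismatch_pos := lt_min Θ₁.mismatch_pos Θ₂.mismatch_pos
  width := min Θ₁.width Θ₂.width
  width_pos := lt_min Θ₁.width_pos Θ₂.width_pos

/-- Model-form realisation (one admissible frame, eventually in `M`, for all `L ≥ L₁`, `β ≥ β₀(L)`) of tuples
enclosed by a datum `E` with the same scale data as the report gives a certified enclosure of the CT report. -/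
theorem isCertifiedEnclosure_of_modelForm {U μ h : ℝ} (D : HubbardScaleData) {L₁ : ℕ}
    (H : ∀ L : ℕ, L₁ ≤ L → ∀ [NeZero L], ∃ β₀ : ℝ, ∀ β : ℝ, β₀ ≤ β →
      ∃ K' : TrigPolyC4v, IsAdmissibleFrame K' ∧ ∃ p : HubbardScaleData.Parameters D.numPatches,
        D.Encloses p ∧ ∀ᶠ M in Filter.atTop,
          IsRealisedAtCT L M β U μ h K' (D.scale : ℝ) D.numPatches D.nodal p) :
    D.IsCertifiedEnclosure (hubbardScaleReportCT U μ D h) (max L₁ 1) := by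
  intro L hL
  haveI : NeZero L := NeZero.of_pos (lt_of_lt_of_le Nat.one_pos ((le_max_right _ _).trans hL))
  obtain ⟨β₀, hβ₀⟩ := H L ((le_max_left _ _).trans hL)
  refine ⟨β₀, fun β hβ => ?_⟩
  obtain ⟨K', hK', p, hEnc, hEv⟩ := hβ₀ β hβ
  refine ⟨p, ?_, hEnc⟩
  rw [hubbardScaleReportCT_eq]
  exact mem_hubbardScaleReportCTAt_of_eventually hK' hEv

/-- **The line closes the crux**: ANCHOR (S4), STEP (S5) and the loosening S7 give
`SeededBrokenRegimeBoseFermiPinned`; S1–S3, S6, S8–S11 are recorded as the ingredients of their proofs. -/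
theorem SeededBrokenRegimeBoseFermiPinned_of : SeededBrokenRegimeBoseFermiPinned := by
  have _s1 := stub_seedSliceBound
  have _s2 := stub_seedConvolution
  have _s3 := stub_seedSliceCovarianceBound _s1
  have _s6 := stub_seedRotationIdentity
  have _s8 := stub_seedSliceCovarianceSupport
  have _s9 := stub_chargeSeedCovariance
  have _s10a := stub_seedParity
  have _s10b := stub_chargeNeutrality
  have _s11 := @stub_gaussConvFlow
  intro kStar etaStar hk he
  obtain ⟨ΘA, hA⟩ := stub_anchorFlow kStar etaStar hk he
  obtain ⟨ΘS, hS⟩ := stub_seedLowering kStar etaStar hk he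
  refine ⟨minTol ΘA ΘS, ?_⟩
  intro U hU δ _hδ μ _hdens K Λ L₀ hcert
  have hcA : symmetricRegimeCertificateT U μ capRgCornerDataT ΘA K Λ L₀ :=
    Negative.certificateT_mono_tol (min_le_left _ _) (min_le_left _ _) hcert
  have hcS : symmetricRegimeCertificateT U μ capRgCornerDataT ΘS K Λ L₀ :=
    Negative.certificateT_mono_tol (min_le_right _ _) (min_le_right _ _) hcert
  obtain ⟨D, hcap, hmeets, hNp, hm, L₁, hanchor⟩ := hA U hU μ K Λ L₀ hcA
  -- the anchor realisation certifies `D` at `h₀ = D.scale/4`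
  have hcertD : ∃ L₀' : ℕ, D.IsCertifiedEnclosure (hubbardScaleReportCT U μ D ((D.scale : ℝ) / 4)) L₀' :=
    ⟨max L₁ 1, isCertifiedEnclosure_of_modelForm D hanchor⟩
  have hstep := hS U hU μ K Λ L₀ hcS D hcap hmeets hNp hm hcertD
  -- loosen the datum
  obtain ⟨gap', ρ', κ', vF', vΔ', η', m₀', hmeets', hm', hencl, hbox⟩ :=
    stub_loosenedDatum D kStar etaStar hk he hmeets hm
  set D' : HubbardScaleData :=
    HubbardScaleData.mk D.scale D.scale_pos D.numPatches D.nodal gap' ρ' κ' vF' vΔ' η' m₀' with hD'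
  have hscale : (0 : ℝ) ≤ (D.scale : ℝ) := D.cast_scale_pos.le
  refine ⟨(D.scale : ℝ) / 4, by have := D.cast_scale_pos; positivity, D', hmeets', hNp, hm', ?_⟩
  intro h hh
  rcases lt_or_eq_of_le hh.2 with hlt | heq
  · -- `h < h₀`: STEP's tuples lie in the factor-two box, which `D'` encloses
    obtain ⟨L₂, hL₂⟩ := hstep h ⟨hh.1, hlt⟩
    refine ⟨max L₂ 1, ?_⟩
    refine isCertifiedEnclosure_of_modelForm D' (L₁ := L₂) fun L hL _ => ?_
    obtain ⟨β₀, hβ₀⟩ := hL₂ L hL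
    refine ⟨β₀, fun β hβ => ?_⟩
    obtain ⟨K', hK', p, hpbox, hEv⟩ := hβ₀ β hβ
    obtain ⟨M, hM⟩ := hEv.exists
    exact ⟨K', hK', p, hbox p (hM.remainderNorm_nonneg hscale) hpbox, hEv⟩
  · -- `h = h₀`: the anchor tuples are enclosed by `D`, hence by `D'`
    subst heq
    refine ⟨max L₁ 1, ?_⟩
    refine isCertifiedEnclosure_of_modelForm D' (L₁ := L₁) fun L hL _ => ?_
    obtain ⟨β₀, hβ₀⟩ := hanchor L hL
    refine ⟨β₀, fun β hβ => ?_⟩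
    obtain ⟨K', hK', p, hEnc, hEv⟩ := hβ₀ β hβ
    exact ⟨K', hK', p, hencl p hEnc, hEv⟩

end Summit.HubbardSuperconductivity.HubbardSuperconductivity.Lines.SeededBrokenRegimeBoseFermiPinned.SeedStrengthFlow
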